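import Literature.AlgebraicGeometry.ModuliOfAbelianVarieties.SiegelAdmissibleClassUnique
import Literature.AlgebraicGeometry.ModuliOfAbelianVarieties.SiegelShimuraSetPrincipalDissection
import HarnessLib

/-!
# The Siegel class of an admissible triple is unique — TWO representatives ([Milne 2005] Thm. 6.11, Lemma 5.12/5.13)

Topic `Literature/AlgebraicGeometry/ModuliOfAbelianVarieties`; namespace `Literature.AlgebraicGeometry.ModuliOfAbelianVarieties`.
Sequel to ★ `SiegelAdmissibleClassUnique` (cell hodgecm-mathlib, U-DAG brick B1 = U-c (i)): there both admissibilities of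
the triple `P′` were read through ONE integral representative `r`; here `P′` is admissible at `(Z, r)` and at `(Z′, r′)`
for two integral representatives `r, r′ ∈ K_δ(1)` and the conclusion is `[J(Z), r·K_δ(N)] = [J(Z′), r′·K_δ(N)]`
(`siegelShimuraSet_mk_eq_of_isAdmissibleAt₂`).  COROLLARY (U-DAG node U-b, «the class `c` is unique»): for the principal
representatives `r_c`, `r_{c′}` of two residues `c, c′ ∈ (ℤ/N)ˣ` (in the shape of ★ `SiegelShimuraSet.exists_principalRep` /
the (U3) clause of ★ `siegelModuli_complexUniformisation`), admissibility of one `P′` at `(Z, r_c)` and at `(Z′, r_{c′})`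
forces `c = c′` (★ R60-27 disjointness of the principal pieces, `intCast_dvd_sub_of_mk_jOfSiegel_eq_mk_jOfSiegel`) —
the well-definedness of the component map `x ↦ c(x)` on `𝓜(ℂ)`.  ROAD: the rational representation `q` of `𝟙`
between the two markings (★ R60-56); reading the common level-`N` structure through the residue towers `Γ, Γ′` of
`r⁻¹, r′⁻¹` (★ `exists_similitudeTower`) gives `q ∈ M_{2g}(ℤ)` with `q̄ = Γ′_N⁻¹ Γ_N`; the two `pairing` clauses and
witness-independence (★ `IsLambdaOfAt.weilPairingLevel_eq`) make `q` a rational similitude; then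
`k := r′⁻¹ q̂ r ∈ K_δ(N)` by the residue criterion of ★ D6 (`exists_monoidHom_principalLevelSubgroup_one_integralAdeleResidue`)
and ★ `SiegelAdelicMarking.mk_eq_mk_of_hom` (for `𝟙`) concludes.  THEOREMS ONLY (no definition, no named fact, no instance,
no `sorry`); (U) is NOT assumed.  HC_CM is proved only modulo the printed citations until rung 0 closes.

## References
* [Milne2005ShimuraVarieties] J. S. Milne, *Introduction to Shimura Varieties* (2005), §6 Thm. 6.11 pp. 74–75, Lemma 5.12–5.13
  p. 57, Thm. 5.17 p. 59.
* [Deligne1971TravauxShimura] P. Deligne, *Travaux de Shimura*, Sém. Bourbaki 389 (1971), 4.12 (b) p. 149, 4.16 p. 150.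
* [Lange2023AbelianVarietiesComplex] H. Lange, *Abelian Varieties over the Complex Numbers* (2023), §3.1.2 Prop. 3.1.4.
* [Lan2013PELCompactifications] K.-W. Lan, *Arithmetic compactifications of PEL-type Shimura varieties* (2013), §1.3.6.
-/

set_option autoImplicit false

noncomputable section

open Matrix CategoryTheory AlgebraicGeometry NumberField IsDedekindDomain
open Literature.AlgebraicGeometry.Motives (AbelianVariety AlgPoints CartierDivisor specOver)
open Literature.AlgebraicGeometry.AbelianSchemes (AbelianSchemeOver PolarizedAbelianSchemeWithLevel)
open Literature.NumberTheory.Adeles (latticeOfGL mem_latticeOfGL_one_iff integralAdeleResidue integralAdeleResidue_intCast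
  exists_monoidHom_principalLevelSubgroup_one_integralAdeleResidue)
open Literature.NumberTheory.Automorphic (siegelUpperHalfSpace)

namespace Literature.AlgebraicGeometry.ModuliOfAbelianVarieties

open SiegelModuli

variable {g : ℕ} {δ : Fin g → ℕ}

/-! ### §0. Elementary lemmas (private twins of the helpers of ★ `SiegelAdmissibleClassUnique`) -/

section Elementary

/-- A rational matrix carrying EVERY rational vector to an integer vector is zero. [folklore] -/
private theorem eq_zero_of_forall_mulVec_int {n : Type*} [Fintype n] [DecidableEq n] (D : Matrix n n ℚ)
    (h : ∀ v : n → ℚ, ∀ i, ∃ z : ℤ, (z : ℚ) = (D *ᵥ v) i) : D = 0 := by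
  ext i j
  rw [Matrix.zero_apply]
  by_contra hne
  obtain ⟨z, hz⟩ := h (Pi.single j (1 / (2 * D i j))) i
  rw [Matrix.mulVec, dotProduct_single] at hz
  have h2 : (((2 * z : ℤ)) : ℚ) = 1 := by
    push_cast
    rw [hz]
    field_simp
  have h2' : (2 * z : ℤ) = 1 := by exact_mod_cast h2
  omega

/-- An integer divisible by `N·k` for every `k ≥ 1` (`N ≥ 1`) is zero. [folklore] -/
private theorem int_eq_zero_of_forall_dvd {N : ℕ} (hN : N ≠ 0) {z : ℤ} (h : ∀ k : ℕ, k ≠ 0 → ((N * k : ℕ) : ℤ) ∣ z) : z = 0 := by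
  refine Int.eq_zero_of_dvd_of_natAbs_lt_natAbs (h (z.natAbs + 1) (Nat.succ_ne_zero _)) ?_
  rw [Int.natAbs_natCast]
  have h1 : 1 ≤ N := Nat.one_le_iff_ne_zero.2 hN
  nlinarith [z.natAbs.zero_le]

/-- Two primitive `M`-th roots of unity are coprime powers of one another. [folklore] -/
private theorem exists_coprime_pow_eq_of_isPrimitiveRoot' {K : Type*} [CommRing K] [IsDomain K] {M : ℕ} (hM : M ≠ 0) {ζ₁ ζ₂ : K}
    (h₁ : IsPrimitiveRoot ζ₁ M) (h₂ : IsPrimitiveRoot ζ₂ M) : ∃ b : ℕ, b.Coprime M ∧ ζ₁ ^ b = ζ₂ := by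
  haveI : NeZero M := ⟨hM⟩
  obtain ⟨b, -, hb⟩ := h₁.eq_pow_of_pow_eq_one h₂.pow_eq_one
  refine ⟨b, ?_, hb⟩
  have := (h₁.pow_iff_coprime (Nat.pos_of_ne_zero hM) b).1 (hb ▸ h₂)
  exact this

/-- For an integer matrix `Q` and a label `x ∈ (ℤ/M)^n`: the rational vectors `Q · (x̃/M)` and `(Q̄ x)~/M` differ by an
integer vector (both numerators reduce to `Q̄ x` mod `M`). [folklore] -/
private theorem exists_int_eq_map_mulVec_val_div_sub {n : Type*} [Fintype n] [DecidableEq n] {M : ℕ} [NeZero M]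
    (Q : Matrix n n ℤ) (x : n → ZMod M) (i : n) :
    ∃ z : ℤ, (z : ℚ) = (Q.map (Int.castRingHom ℚ) *ᵥ fun j => ((x j).val : ℚ) / M) i -
      ((((Q.map (Int.castRingHom (ZMod M)) *ᵥ x) i).val : ℚ) / M) := by
  have hMQ : (M : ℚ) ≠ 0 := by exact_mod_cast NeZero.ne M
  -- the two numerators
  set S : ℤ := ∑ j, Q i j * ((x j).val : ℤ) with hS
  have hnum : (Q.map (Int.castRingHom ℚ) *ᵥ fun j => ((x j).val : ℚ) / M) i = (S : ℚ) / M := by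
    rw [Matrix.mulVec, dotProduct, hS]
    push_cast
    rw [Finset.sum_div]
    refine Finset.sum_congr rfl fun j _ => ?_
    rw [Matrix.map_apply, eq_intCast]
    ring
  have hred : ((S : ℤ) : ZMod M) = (Q.map (Int.castRingHom (ZMod M)) *ᵥ x) i := by
    rw [hS, Matrix.mulVec, dotProduct]
    push_cast
    refine Finset.sum_congr rfl fun j _ => ?_
    rw [Matrix.map_apply, eq_intCast, ZMod.natCast_zmod_val]
  have hdvd : (M : ℤ) ∣ S - (((Q.map (Int.castRingHom (ZMod M)) *ᵥ x) i).val : ℤ) := by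
    rw [← ZMod.intCast_zmod_eq_zero_iff_dvd, Int.cast_sub, hred, Int.cast_natCast, ZMod.natCast_zmod_val, sub_self]
  obtain ⟨z, hz⟩ := hdvd
  refine ⟨z, ?_⟩
  rw [hnum, div_sub_div_same]
  have : ((S : ℚ) - (((Q.map (Int.castRingHom (ZMod M)) *ᵥ x) i).val : ℚ)) = (M : ℚ) * z := by exact_mod_cast hz
  rw [this, mul_div_cancel_left₀ _ hMQ]

end Elementary

/-! ### §1. Two markings of one fibre by `[J, r]` and `[J′, r′]`, each matched to a lift of the same level structure -/

section TwoReps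

variable {N : ℕ} {S : Scheme} {B : AbelianSchemeOver S} {s : Spec (.of ℂ) ⟶ S} {φ : B.LevelStructure g N}
  {Θ Θ' : CartierDivisor (B.fibre s).toAbelianVariety.X.left}
  {J J' : C0pm δ} {r r' : gspFinAdelic δ}

/-- Matrix-coefficient bookkeeping: `(Q eᵢ) · E (Q eⱼ) = (ᵗQ E Q)ᵢⱼ`. [folklore] -/
private theorem mulVec_single_dotProduct_mulVec {n R : Type*} [Fintype n] [DecidableEq n] [CommRing R]
    (Q E : Matrix n n R) (i j : n) :
    (Q *ᵥ Pi.single i 1) ⬝ᵥ (E *ᵥ (Q *ᵥ Pi.single j 1)) = (Qᵀ * E * Q) i j := by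
  have h1 : Q *ᵥ Pi.single i (1 : R) = fun a => Q a i := by
    funext a; rw [Matrix.mulVec, dotProduct_single, mul_one]
  have h2 : Q *ᵥ Pi.single j (1 : R) = fun a => Q a j := by
    funext a; rw [Matrix.mulVec, dotProduct_single, mul_one]
  rw [h1, h2, Matrix.mul_assoc, Matrix.mul_apply]
  simp only [Matrix.transpose_apply, Matrix.mul_apply, dotProduct, Matrix.mulVec]

/-- `eᵢ · E eⱼ = Eᵢⱼ`. [folklore] -/
private theorem single_dotProduct_mulVec_single {n R : Type*} [Fintype n] [DecidableEq n] [CommRing R]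
    (E : Matrix n n R) (i j : n) :
    (Pi.single i (1 : R)) ⬝ᵥ (E *ᵥ Pi.single j 1) = E i j := by
  rw [single_dotProduct, one_mul, Matrix.mulVec, dotProduct_single, mul_one]

/-- **Two markings of one fibre by `[J, r]`, `[J′, r′]`, matched to lifts of the SAME level-`N` structure, are compared on
the `N`-torsion by the residues of `r⁻¹, r′⁻¹`**: if `Γ_N, Γ′_N ∈ GL_{2g}(ℤ/N)` reduce `r⁻¹, r′⁻¹` entrywise (★ D6
`integralAdeleResidue`), then `u(x̃/N) = u′(ỹ/N)` with `y = Γ′_N⁻¹ Γ_N x` — both sides are `Λ_N(Γ_N x) = Λ′_N(Γ_N x)`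
(★ `coe_symplecticLift_level_eq`). [cite: Milne2005ShimuraVarieties, §6 Thm. 6.11 p. 75 («ηK ↦ η′K»)]
[cite: Deligne1971TravauxShimura, 4.16 p. 150] -/
theorem r_val_div_eq_r_val_div_of_lifts₂ [NeZero N]
    (hr : r ∈ principalLevelSubgroup δ 1) (hr' : r' ∈ principalLevelSubgroup δ 1)
    (ΓN Γ'N : GL (Fin g ⊕ Fin g) (ZMod N))
    (hΓN : ∀ (i j : Fin g ⊕ Fin g)
      (h : (((r⁻¹ : gspFinAdelic δ) : GL (Fin g ⊕ Fin g) finAdeleQ) : Matrix (Fin g ⊕ Fin g) (Fin g ⊕ Fin g) finAdeleQ) i j ∈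
        FiniteAdeleRing.integralAdeles (𝓞 ℚ) ℚ),
      (ΓN : Matrix (Fin g ⊕ Fin g) (Fin g ⊕ Fin g) (ZMod N)) i j = integralAdeleResidue N ⟨_, h⟩)
    (hΓ'N : ∀ (i j : Fin g ⊕ Fin g)
      (h : (((r'⁻¹ : gspFinAdelic δ) : GL (Fin g ⊕ Fin g) finAdeleQ) : Matrix (Fin g ⊕ Fin g) (Fin g ⊕ Fin g) finAdeleQ) i j ∈
        FiniteAdeleRing.integralAdeles (𝓞 ℚ) ℚ),
      (Γ'N : Matrix (Fin g ⊕ Fin g) (Fin g ⊕ Fin g) (ZMod N)) i j = integralAdeleResidue N ⟨_, h⟩)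
    (Λ : φ.SymplecticLift s Θ δ) (m : SiegelAdelicMarking J r (B.fibre s).toAbelianVariety)
    (hΛ : ∀ ⦃M : ℕ⦄, N ∣ M → M ≠ 0 → ∀ (x : Fin g ⊕ Fin g → ZMod M) (v : Fin g ⊕ Fin g → ℚ),
      AdelicCongr ((r⁻¹ : gspFinAdelic δ) : GL (Fin g ⊕ Fin g) finAdeleQ) 1 v (fun i => ((x i).val : ℚ) / M) →
        ((Λ.lift M (Multiplicative.ofAdd x)) : (B.fibre s).toAbelianVariety.Points ℂ) = m.r v)
    (Λ' : φ.SymplecticLift s Θ' δ) (m' : SiegelAdelicMarking J' r' (B.fibre s).toAbelianVariety)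
    (hΛ' : ∀ ⦃M : ℕ⦄, N ∣ M → M ≠ 0 → ∀ (x : Fin g ⊕ Fin g → ZMod M) (v : Fin g ⊕ Fin g → ℚ),
      AdelicCongr ((r'⁻¹ : gspFinAdelic δ) : GL (Fin g ⊕ Fin g) finAdeleQ) 1 v (fun i => ((x i).val : ℚ) / M) →
        ((Λ'.lift M (Multiplicative.ofAdd x)) : (B.fibre s).toAbelianVariety.Points ℂ) = m'.r v)
    (x : Fin g ⊕ Fin g → ZMod N) :
    m.r (fun i => ((x i).val : ℚ) / N) =
      m'.r (fun i => (((((Γ'N⁻¹ * ΓN : GL (Fin g ⊕ Fin g) (ZMod N)) : Matrix (Fin g ⊕ Fin g) (Fin g ⊕ Fin g) (ZMod N)) *ᵥ x) i).val : ℚ) / N) := by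
  have hc := adelicCongr_val_div_of_entries_residue (inv_mem hr : r⁻¹ ∈ principalLevelSubgroup δ 1)
    (ΓN : Matrix (Fin g ⊕ Fin g) (Fin g ⊕ Fin g) (ZMod N)) hΓN x
  have hc' := adelicCongr_val_div_of_entries_residue (inv_mem hr' : r'⁻¹ ∈ principalLevelSubgroup δ 1)
    (Γ'N : Matrix (Fin g ⊕ Fin g) (Fin g ⊕ Fin g) (ZMod N)) hΓ'N
    (((Γ'N⁻¹ * ΓN : GL (Fin g ⊕ Fin g) (ZMod N)) : Matrix (Fin g ⊕ Fin g) (Fin g ⊕ Fin g) (ZMod N)) *ᵥ x)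
  have hy : (Γ'N : Matrix (Fin g ⊕ Fin g) (Fin g ⊕ Fin g) (ZMod N)) *ᵥ
      ((((Γ'N⁻¹ * ΓN : GL (Fin g ⊕ Fin g) (ZMod N)) : Matrix (Fin g ⊕ Fin g) (Fin g ⊕ Fin g) (ZMod N)) *ᵥ x)) =
      (ΓN : Matrix (Fin g ⊕ Fin g) (Fin g ⊕ Fin g) (ZMod N)) *ᵥ x := by
    rw [Matrix.mulVec_mulVec, ← Units.val_mul, mul_inv_cancel_left]
  rw [← hΛ (dvd_refl N) (NeZero.ne N) _ _ hc, ← hΛ' (dvd_refl N) (NeZero.ne N) _ _ hc', hy]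
  exact coe_symplecticLift_level_eq Λ Λ' _

/-- **The rational representative of `𝟙` between the two markings is INTEGRAL with reduction `q̄ = Γ′_N⁻¹ Γ_N`.**
If `u(v) = u′(q v)` for all `v` (★ `SiegelAdelicMarking.exists_ratRep_of_hom` for `𝟙`), then `q = Q ∈ M_{2g}(ℤ)` with
`Q mod N = Γ′_N⁻¹ Γ_N`: the class `eⱼ/N` is read by `u` as `u′(ỹⱼ/N)`, `yⱼ = Γ′_N⁻¹ Γ_N eⱼ` (`r_val_div_eq_r_val_div_of_lifts₂`),
so `q eⱼ − ỹⱼ ∈ N·Λ_{r′} = N·ℤ^{2g}`. [cite: Milne2005ShimuraVarieties, Lemma 5.13 p. 57 (footnote 40)]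
[cite: Deligne1971TravauxShimura, 4.16 p. 150] -/
theorem exists_intMatrix_of_ratRep_of_lifts₂ [NeZero N] (hN1 : 1 < N)
    (hr : r ∈ principalLevelSubgroup δ 1) (hr' : r' ∈ principalLevelSubgroup δ 1)
    (ΓN Γ'N : GL (Fin g ⊕ Fin g) (ZMod N))
    (hΓN : ∀ (i j : Fin g ⊕ Fin g)
      (h : (((r⁻¹ : gspFinAdelic δ) : GL (Fin g ⊕ Fin g) finAdeleQ) : Matrix (Fin g ⊕ Fin g) (Fin g ⊕ Fin g) finAdeleQ) i j ∈
        FiniteAdeleRing.integralAdeles (𝓞 ℚ) ℚ),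
      (ΓN : Matrix (Fin g ⊕ Fin g) (Fin g ⊕ Fin g) (ZMod N)) i j = integralAdeleResidue N ⟨_, h⟩)
    (hΓ'N : ∀ (i j : Fin g ⊕ Fin g)
      (h : (((r'⁻¹ : gspFinAdelic δ) : GL (Fin g ⊕ Fin g) finAdeleQ) : Matrix (Fin g ⊕ Fin g) (Fin g ⊕ Fin g) finAdeleQ) i j ∈
        FiniteAdeleRing.integralAdeles (𝓞 ℚ) ℚ),
      (Γ'N : Matrix (Fin g ⊕ Fin g) (Fin g ⊕ Fin g) (ZMod N)) i j = integralAdeleResidue N ⟨_, h⟩)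
    (Λ : φ.SymplecticLift s Θ δ) (m : SiegelAdelicMarking J r (B.fibre s).toAbelianVariety)
    (hΛ : ∀ ⦃M : ℕ⦄, N ∣ M → M ≠ 0 → ∀ (x : Fin g ⊕ Fin g → ZMod M) (v : Fin g ⊕ Fin g → ℚ),
      AdelicCongr ((r⁻¹ : gspFinAdelic δ) : GL (Fin g ⊕ Fin g) finAdeleQ) 1 v (fun i => ((x i).val : ℚ) / M) →
        ((Λ.lift M (Multiplicative.ofAdd x)) : (B.fibre s).toAbelianVariety.Points ℂ) = m.r v)
    (Λ' : φ.SymplecticLift s Θ' δ) (m' : SiegelAdelicMarking J' r' (B.fibre s).toAbelianVariety)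
    (hΛ' : ∀ ⦃M : ℕ⦄, N ∣ M → M ≠ 0 → ∀ (x : Fin g ⊕ Fin g → ZMod M) (v : Fin g ⊕ Fin g → ℚ),
      AdelicCongr ((r'⁻¹ : gspFinAdelic δ) : GL (Fin g ⊕ Fin g) finAdeleQ) 1 v (fun i => ((x i).val : ℚ) / M) →
        ((Λ'.lift M (Multiplicative.ofAdd x)) : (B.fibre s).toAbelianVariety.Points ℂ) = m'.r v)
    {q : Matrix (Fin g ⊕ Fin g) (Fin g ⊕ Fin g) ℚ} (hq : ∀ v, m.r v = m'.r (q *ᵥ v)) :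
    ∃ Q : Matrix (Fin g ⊕ Fin g) (Fin g ⊕ Fin g) ℤ,
      Q.map (Int.castRingHom ℚ) = q ∧
        Q.map (Int.castRingHom (ZMod N)) =
          ((Γ'N⁻¹ * ΓN : GL (Fin g ⊕ Fin g) (ZMod N)) : Matrix (Fin g ⊕ Fin g) (Fin g ⊕ Fin g) (ZMod N)) := by
  haveI : Fact (1 < N) := ⟨hN1⟩
  have hNQ : (N : ℚ) ≠ 0 := by exact_mod_cast NeZero.ne N
  set T : Matrix (Fin g ⊕ Fin g) (Fin g ⊕ Fin g) (ZMod N) :=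
    ((Γ'N⁻¹ * ΓN : GL (Fin g ⊕ Fin g) (ZMod N)) : Matrix (Fin g ⊕ Fin g) (Fin g ⊕ Fin g) (ZMod N)) with hT
  have hTe : ∀ i j, (T *ᵥ (Pi.single j (1 : ZMod N) : Fin g ⊕ Fin g → ZMod N)) i = T i j := fun i j => by
    rw [Matrix.mulVec, dotProduct_single, mul_one]
  have hcj : ∀ j, (fun k => (((Pi.single j (1 : ZMod N) : Fin g ⊕ Fin g → ZMod N) k).val : ℚ) / N) =
      fun k => (Pi.single j (1 : ℚ) : Fin g ⊕ Fin g → ℚ) k / N := fun j => by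
    funext k
    rcases eq_or_ne k j with rfl | hk
    · simp [ZMod.val_one]
    · simp [hk]
  -- `q_{ij} = T̃_{ij} + N z_{ij}`
  have hint : ∀ i j, ∃ z : ℤ, (z : ℚ) = q i j / N - ((T i j).val : ℚ) / N := by
    intro i j
    have h1 := r_val_div_eq_r_val_div_of_lifts₂ hr hr' ΓN Γ'N hΓN hΓ'N Λ m hΛ Λ' m' hΛ' (Pi.single j 1)
    rw [hq, ← hT] at h1
    have h2 := (m'.r_eq_r_iff_sub_mem_latticeOfGL _ _).1 h1
    rw [latticeOfGL_coe_eq_one_of_mem_principalLevelSubgroup_one hr', mem_latticeOfGL_one_iff] at h2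
    obtain ⟨z, hz⟩ := h2 i
    refine ⟨z, ?_⟩
    rw [hz, Pi.sub_apply, hTe, hcj, Matrix.mulVec, dotProduct]
    simp only [Pi.single_apply]
    rw [Finset.sum_eq_single j (fun k _ hk => by simp [hk]) (fun h => (h (Finset.mem_univ j)).elim)]
    simp only [if_true, mul_one_div]
  choose Zf hZf using hint
  refine ⟨Matrix.of fun i j => ((T i j).val : ℤ) + (N : ℤ) * Zf i j, ?_, ?_⟩
  · ext i j
    have h := hZf i j
    rw [div_sub_div_same, eq_div_iff hNQ] at h
    simp only [Matrix.map_apply, Matrix.of_apply, eq_intCast, Int.cast_add, Int.cast_mul, Int.cast_natCast]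
    linarith
  · ext i j
    simp only [Matrix.map_apply, Matrix.of_apply, eq_intCast, Int.cast_add, Int.cast_mul, Int.cast_natCast,
      ZMod.natCast_self, zero_mul, add_zero, ZMod.natCast_zmod_val]

/-- **THE SIMILITUDE STEP, two representatives.**  With `hpair` the witness-independence of the level Weil pairings (★
`IsLambdaOfAt.weilPairingLevel_eq` shape) and `u(v) = u′(Q v)` for an INTEGER matrix `Q`, one has
`δ₀ • ᵗQ E_δ Q = (ᵗQ E_δ Q)₀ • E_δ`: at level `M` the two towers satisfy `Λ_M(Γ_M x) = Λ′_M(Γ′_M Q̄ x)` (`Γ, Γ′` the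
residue towers of `r⁻¹, r′⁻¹`, ★ `exists_similitudeTower`), so the two `pairing` clauses give
`E_δ(x, y) ≡ c_M · E_δ(Q̄x, Q̄y) (mod M)`; a congruence modulo every `N·k` is an equality.
[cite: Milne2005ShimuraVarieties, §6 Thm. 6.11 pp. 74–75] [cite: Lange2023AbelianVarietiesComplex, §3.1.2 Prop. 3.1.4]
[cite: Deligne1971TravauxShimura, 4.12 (b) p. 149] -/
theorem smul_transpose_mul_typeForm_mul_eq_of_lifts₂ (hδ : IsPolarizationType δ) (hg : 0 < g) (hN : N ≠ 0)
    (hr : r ∈ principalLevelSubgroup δ 1) (hr' : r' ∈ principalLevelSubgroup δ 1)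
    (Λ : φ.SymplecticLift s Θ δ) (m : SiegelAdelicMarking J r (B.fibre s).toAbelianVariety)
    (hΛ : ∀ ⦃M : ℕ⦄, N ∣ M → M ≠ 0 → ∀ (x : Fin g ⊕ Fin g → ZMod M) (v : Fin g ⊕ Fin g → ℚ),
      AdelicCongr ((r⁻¹ : gspFinAdelic δ) : GL (Fin g ⊕ Fin g) finAdeleQ) 1 v (fun i => ((x i).val : ℚ) / M) →
        ((Λ.lift M (Multiplicative.ofAdd x)) : (B.fibre s).toAbelianVariety.Points ℂ) = m.r v)
    (Λ' : φ.SymplecticLift s Θ' δ) (m' : SiegelAdelicMarking J' r' (B.fibre s).toAbelianVariety)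
    (hΛ' : ∀ ⦃M : ℕ⦄, N ∣ M → M ≠ 0 → ∀ (x : Fin g ⊕ Fin g → ZMod M) (v : Fin g ⊕ Fin g → ℚ),
      AdelicCongr ((r'⁻¹ : gspFinAdelic δ) : GL (Fin g ⊕ Fin g) finAdeleQ) 1 v (fun i => ((x i).val : ℚ) / M) →
        ((Λ'.lift M (Multiplicative.ofAdd x)) : (B.fibre s).toAbelianVariety.Points ℂ) = m'.r v)
    (hpair : ∀ ⦃M : ℕ⦄ [IsDominant (AbelianVariety.Hom.toSchemeHom (((M : ℕ) : ℤ) • 𝟙 (B.fibre s).toAbelianVariety))]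
      (P P' : (B.fibre s).toAbelianVariety.torsionPoints ℂ (M : ℤ)),
      (B.fibre s).toAbelianVariety.weilPairingLevel Θ P P' = (B.fibre s).toAbelianVariety.weilPairingLevel Θ' P P')
    {Q : Matrix (Fin g ⊕ Fin g) (Fin g ⊕ Fin g) ℤ} (hq : ∀ v, m.r v = m'.r (Q.map (Int.castRingHom ℚ) *ᵥ v)) :
    (typeForm δ (Sum.inl ⟨0, hg⟩) (Sum.inr ⟨0, hg⟩)) • (Qᵀ * typeForm δ * Q) =
      ((Qᵀ * typeForm δ * Q) (Sum.inl ⟨0, hg⟩) (Sum.inr ⟨0, hg⟩)) • typeForm δ := by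
  obtain ⟨Γ, ν, hΓres, -, -, hΓsim⟩ := exists_similitudeTower δ hδ hg (inv_mem hr : r⁻¹ ∈ principalLevelSubgroup δ 1)
  obtain ⟨Γ', ν', hΓ'res, -, -, hΓ'sim⟩ :=
    exists_similitudeTower δ hδ hg (inv_mem hr' : r'⁻¹ ∈ principalLevelSubgroup δ 1)
  set F : Matrix (Fin g ⊕ Fin g) (Fin g ⊕ Fin g) ℤ := Qᵀ * typeForm δ * Q with hF
  -- Step 1: at every level `M = N·k` the reductions of `E_δ` and `F` are proportional
  have hlevel : ∀ k : ℕ, k ≠ 0 → ∃ b : ZMod (N * k),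
      (typeForm δ).map (Int.castRingHom (ZMod (N * k))) = b • F.map (Int.castRingHom (ZMod (N * k))) := by
    intro k hk
    have hM0 : N * k ≠ 0 := mul_ne_zero hN hk
    haveI : NeZero (N * k) := ⟨hM0⟩
    have hNM : N ∣ N * k := Dvd.intro k rfl
    have hMℂ : ((N * k : ℕ) : ℂ) ≠ 0 := by exact_mod_cast hM0
    haveI := AbelianVariety.isDominant_toSchemeHom_zsmul_of_ne_zero (B.fibre s).toAbelianVariety hMℂ
    set ΓM : Matrix (Fin g ⊕ Fin g) (Fin g ⊕ Fin g) (ZMod (N * k)) :=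
      ((Γ (N * k) : GL (Fin g ⊕ Fin g) (ZMod (N * k))) : Matrix (Fin g ⊕ Fin g) (Fin g ⊕ Fin g) (ZMod (N * k)))
      with hΓM
    set Γ'M : Matrix (Fin g ⊕ Fin g) (Fin g ⊕ Fin g) (ZMod (N * k)) :=
      ((Γ' (N * k) : GL (Fin g ⊕ Fin g) (ZMod (N * k))) : Matrix (Fin g ⊕ Fin g) (Fin g ⊕ Fin g) (ZMod (N * k)))
      with hΓ'M
    set Qb : Matrix (Fin g ⊕ Fin g) (Fin g ⊕ Fin g) (ZMod (N * k)) := Q.map (Int.castRingHom (ZMod (N * k))) with hQb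
    -- (**) the two towers compared through `q`
    have hstar : ∀ x : Fin g ⊕ Fin g → ZMod (N * k),
        Λ.lift (N * k) (Multiplicative.ofAdd (ΓM *ᵥ x)) =
          Λ'.lift (N * k) (Multiplicative.ofAdd (Γ'M *ᵥ (Qb *ᵥ x))) := by
      intro x
      apply Subtype.ext
      have hc := adelicCongr_val_div_of_entries_residue (inv_mem hr : r⁻¹ ∈ principalLevelSubgroup δ 1) ΓM
        (hΓres (N * k)) x
      have hc' := adelicCongr_val_div_of_entries_residue (inv_mem hr' : r'⁻¹ ∈ principalLevelSubgroup δ 1) Γ'M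
        (hΓ'res (N * k)) (Qb *ᵥ x)
      rw [hΛ hNM hM0 _ _ hc, hΛ' hNM hM0 _ _ hc', hq]
      refine (m'.r_eq_r_iff_sub_mem_latticeOfGL _ _).2 ?_
      rw [latticeOfGL_coe_eq_one_of_mem_principalLevelSubgroup_one hr', mem_latticeOfGL_one_iff]
      intro i
      simpa only [Pi.sub_apply] using exists_int_eq_map_mulVec_val_div_sub Q x i
    -- the two root systems at level `M`
    have hζ := Λ.isPrimitiveRoot_ζ hNM hM0
    obtain ⟨b, -, hb⟩ := exists_coprime_pow_eq_of_isPrimitiveRoot' hM0 hζ (Λ'.isPrimitiveRoot_ζ hNM hM0)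
    -- the pairing identity `E(x, y) = c · E(Q̄x, Q̄y)` in `ℤ/M`, `c = ν⁻¹ b ν′`
    have hexp : ∀ x y : Fin g ⊕ Fin g → ZMod (N * k),
        AbelianSchemeOver.typeFormMod δ (N * k) x y =
          (((ν (N * k))⁻¹ : (ZMod (N * k))ˣ) : ZMod (N * k)) * ((b : ZMod (N * k)) * (ν' (N * k) : ZMod (N * k))) *
            AbelianSchemeOver.typeFormMod δ (N * k) (Qb *ᵥ x) (Qb *ᵥ y) := by
      intro x y
      have e1 := Λ.weilPairingLevel_lift hNM hMℂ (ΓM *ᵥ x) (ΓM *ᵥ y)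
      have e2 := Λ'.weilPairingLevel_lift hNM hMℂ (Γ'M *ᵥ (Qb *ᵥ x)) (Γ'M *ᵥ (Qb *ᵥ y))
      rw [hstar x, hstar y, hpair, e2, hΓsim hM0, hΓ'sim hM0, ← hb, ← pow_mul] at e1
      -- `e1 : ζ ^ (b * (ν′ E(Q̄x,Q̄y)).val) = ζ ^ (ν E(x,y)).val`
      have hmod : Λ.ζ (N * k) ^ (b * ((ν' (N * k) : ZMod (N * k)) *
          AbelianSchemeOver.typeFormMod δ (N * k) (Qb *ᵥ x) (Qb *ᵥ y)).val) =
          Λ.ζ (N * k) ^ ((b * ((ν' (N * k) : ZMod (N * k)) *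
            AbelianSchemeOver.typeFormMod δ (N * k) (Qb *ᵥ x) (Qb *ᵥ y)).val) % (N * k)) := by
        conv_lhs => rw [← Nat.mod_add_div (b * ((ν' (N * k) : ZMod (N * k)) *
          AbelianSchemeOver.typeFormMod δ (N * k) (Qb *ᵥ x) (Qb *ᵥ y)).val) (N * k), pow_add, pow_mul,
          hζ.pow_eq_one, one_pow, mul_one]
      rw [hmod] at e1
      have hval := hζ.pow_inj (Nat.mod_lt _ (Nat.pos_of_ne_zero hM0)) (ZMod.val_lt _) e1
      have hz : (b : ZMod (N * k)) * ((ν' (N * k) : ZMod (N * k)) *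
          AbelianSchemeOver.typeFormMod δ (N * k) (Qb *ᵥ x) (Qb *ᵥ y)) =
          (ν (N * k) : ZMod (N * k)) * AbelianSchemeOver.typeFormMod δ (N * k) x y := by
        have := congrArg (fun t : ℕ => (t : ZMod (N * k))) hval
        simpa only [ZMod.natCast_mod, Nat.cast_mul, ZMod.natCast_zmod_val] using this
      calc AbelianSchemeOver.typeFormMod δ (N * k) x y
          = (((ν (N * k))⁻¹ : (ZMod (N * k))ˣ) : ZMod (N * k)) *
              ((ν (N * k) : ZMod (N * k)) * AbelianSchemeOver.typeFormMod δ (N * k) x y) := by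
            rw [Units.inv_mul_cancel_left]
        _ = (((ν (N * k))⁻¹ : (ZMod (N * k))ˣ) : ZMod (N * k)) * ((b : ZMod (N * k)) *
              ((ν' (N * k) : ZMod (N * k)) * AbelianSchemeOver.typeFormMod δ (N * k) (Qb *ᵥ x) (Qb *ᵥ y))) := by
            rw [hz]
        _ = (((ν (N * k))⁻¹ : (ZMod (N * k))ˣ) : ZMod (N * k)) * ((b : ZMod (N * k)) * (ν' (N * k) : ZMod (N * k))) *
              AbelianSchemeOver.typeFormMod δ (N * k) (Qb *ᵥ x) (Qb *ᵥ y) := by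
            ring
    refine ⟨(((ν (N * k))⁻¹ : (ZMod (N * k))ˣ) : ZMod (N * k)) * ((b : ZMod (N * k)) * (ν' (N * k) : ZMod (N * k))), ?_⟩
    ext i j
    have hij := hexp (Pi.single i 1) (Pi.single j 1)
    rw [typeFormMod_eq_dotProduct, typeFormMod_eq_dotProduct, single_dotProduct_mulVec_single,
      mulVec_single_dotProduct_mulVec] at hij
    rw [Matrix.smul_apply, smul_eq_mul, hF, Matrix.map_mul, Matrix.map_mul, Matrix.transpose_map]
    exact hij
  -- Step 2: an integer congruence modulo every `N·k` is an equality
  ext i j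
  rw [Matrix.smul_apply, Matrix.smul_apply, smul_eq_mul, smul_eq_mul]
  have hz : typeForm δ i j * F (Sum.inl ⟨0, hg⟩) (Sum.inr ⟨0, hg⟩) -
      typeForm δ (Sum.inl ⟨0, hg⟩) (Sum.inr ⟨0, hg⟩) * F i j = 0 := by
    refine int_eq_zero_of_forall_dvd hN fun k hk => ?_
    obtain ⟨b, hb⟩ := hlevel k hk
    have hE : ∀ a c, ((typeForm δ a c : ℤ) : ZMod (N * k)) = b * ((F a c : ℤ) : ZMod (N * k)) := fun a c => by
      have := congrFun (congrFun hb a) c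
      simpa only [Matrix.map_apply, Matrix.smul_apply, smul_eq_mul, eq_intCast] using this
    rw [← ZMod.intCast_zmod_eq_zero_iff_dvd]
    push_cast
    rw [hE i j, hE (Sum.inl ⟨0, hg⟩) (Sum.inr ⟨0, hg⟩)]
    ring
  linear_combination -hz

end TwoReps

/-! ### §2. The Siegel class of an admissible triple is unique — two representatives; uniqueness of the component -/

section Main

variable {N : ℕ} {r r' : gspFinAdelic δ} {Z Z' : Matrix (Fin g) (Fin g) ℂ}

/-- **HEAD — [Milne 2005, Thm. 6.11] injectivity for ONE triple read at TWO integral representatives.**  For `0 < g`, a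
polarisation type `δ`, `N ≥ 3`, `r, r′ ∈ K_δ(1)` and `Z, Z′ ∈ 𝔥_g`: if one polarised abelian scheme with level-`N`
structure `P′` over `Spec ℂ` is admissible (★ `IsAdmissibleAt`) at `(Z, r)` and at `(Z′, r′)`, then
`[J(Z), r·K_δ(N)] = [J(Z′), r′·K_δ(N)]`.  Proof: `q` = the rational representation of `𝟙` between the two markings (★
`exists_ratRep_of_hom`); `q ∈ M_{2g}(ℤ)` with `q̄ = Γ′_N⁻¹ Γ_N` (`exists_intMatrix_of_ratRep_of_lifts₂`), `q⁻¹` likewise;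
`q ∈ GSp_δ(ℚ)` (`smul_transpose_mul_typeForm_mul_eq_of_lifts₂`); hence `k := r′⁻¹ q̂ r ∈ K_δ(1)` reduces to
`Γ′_N · Γ′_N⁻¹Γ_N · Γ_N⁻¹ = 1` modulo `N`, i.e. `k ∈ K_δ(N)` (★ D6 kernel criterion), and `k` carries `u` to `u′`
(`u(v) = u′(w)` whenever `k r⁻¹ v̂ ≡ r′⁻¹ ŵ`) — the hypothesis of ★ `SiegelAdelicMarking.mk_eq_mk_of_hom` for `𝟙`.
[cite: Milne2005ShimuraVarieties, §6 Thm. 6.11 pp. 74–75, Lemma 5.13 p. 57] [cite: Deligne1971TravauxShimura, 4.16 p. 150] -/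
theorem siegelShimuraSet_mk_eq_of_isAdmissibleAt₂ (hg : 0 < g) (hδ : IsPolarizationType δ) (hN : 3 ≤ N)
    (hr : r ∈ principalLevelSubgroup δ 1) (hr' : r' ∈ principalLevelSubgroup δ 1)
    (hZ : Z ∈ siegelUpperHalfSpace g) (hZ' : Z' ∈ siegelUpperHalfSpace g)
    (P' : PolarizedAbelianSchemeWithLevel g N δ (specOver ℚ ℂ).left)
    (h : IsAdmissibleAt hδ r Z hZ P') (h' : IsAdmissibleAt hδ r' Z' hZ' P') :
    SiegelShimuraSet.mk δ (principalLevelSubgroup δ N)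
        ⟨jOfSiegel δ Z, SiegelComplexRecordSystem.jOfSiegel_mem_C0pm hδ.1 hZ⟩ r =
      SiegelShimuraSet.mk δ (principalLevelSubgroup δ N)
        ⟨jOfSiegel δ Z', SiegelComplexRecordSystem.jOfSiegel_mem_C0pm hδ.1 hZ'⟩ r' := by
  have hN0 : N ≠ 0 := by omega
  haveI : NeZero N := ⟨hN0⟩
  have hN1 : 1 < N := by omega
  obtain ⟨m, Θ, Λ, -, hΘl, hΛ⟩ := h
  obtain ⟨m', Θ', Λ', -, hΘl', hΛ'⟩ := h'
  -- (0) the residue homomorphism `K_δ(1) → GL_{2g}(ℤ/N)` and the residues `Γ_N, Γ′_N` of `r⁻¹, r′⁻¹`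
  obtain ⟨red, hred, hker⟩ := exists_monoidHom_principalLevelSubgroup_one_integralAdeleResidue N δ
  set ρ : principalLevelSubgroup δ 1 := ⟨r⁻¹, inv_mem hr⟩ with hρ
  set ρ' : principalLevelSubgroup δ 1 := ⟨r'⁻¹, inv_mem hr'⟩ with hρ'
  have hΓN : ∀ (i j : Fin g ⊕ Fin g)
      (hx : (((r⁻¹ : gspFinAdelic δ) : GL (Fin g ⊕ Fin g) finAdeleQ) : Matrix (Fin g ⊕ Fin g) (Fin g ⊕ Fin g) finAdeleQ) i j ∈
        FiniteAdeleRing.integralAdeles (𝓞 ℚ) ℚ),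
      ((red ρ : GL (Fin g ⊕ Fin g) (ZMod N)) : Matrix (Fin g ⊕ Fin g) (Fin g ⊕ Fin g) (ZMod N)) i j =
        integralAdeleResidue N ⟨_, hx⟩ := fun i j hx => hred ρ i j hx
  have hΓ'N : ∀ (i j : Fin g ⊕ Fin g)
      (hx : (((r'⁻¹ : gspFinAdelic δ) : GL (Fin g ⊕ Fin g) finAdeleQ) : Matrix (Fin g ⊕ Fin g) (Fin g ⊕ Fin g) finAdeleQ) i j ∈
        FiniteAdeleRing.integralAdeles (𝓞 ℚ) ℚ),
      ((red ρ' : GL (Fin g ⊕ Fin g) (ZMod N)) : Matrix (Fin g ⊕ Fin g) (Fin g ⊕ Fin g) (ZMod N)) i j =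
        integralAdeleResidue N ⟨_, hx⟩ := fun i j hx => hred ρ' i j hx
  -- (1) the rational representations of `𝟙` between the two markings, in both directions
  obtain ⟨q, hq0, hqJ⟩ := m.exists_ratRep_of_hom m' (𝟙 _)
  obtain ⟨q', hq0', -⟩ := m'.exists_ratRep_of_hom m (𝟙 _)
  have hq : ∀ v, m.r v = m'.r (q *ᵥ v) := fun v => by
    have h := hq0 v
    simp only [AbelianVariety.id_hom] at h
    exact h
  have hq' : ∀ v, m'.r v = m.r (q' *ᵥ v) := fun v => by
    have h := hq0' v
    simp only [AbelianVariety.id_hom] at h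
    exact h
  -- (2) integrality with residues: `Q̄ = Γ′_N⁻¹ Γ_N`, `Q̄′ = Γ_N⁻¹ Γ′_N`
  obtain ⟨Q, hQq, hQN⟩ :=
    exists_intMatrix_of_ratRep_of_lifts₂ hN1 hr hr' (red ρ) (red ρ') hΓN hΓ'N Λ m hΛ Λ' m' hΛ' hq
  obtain ⟨Q', hQ'q, hQ'N⟩ :=
    exists_intMatrix_of_ratRep_of_lifts₂ hN1 hr' hr (red ρ') (red ρ) hΓ'N hΓN Λ' m' hΛ' Λ m hΛ hq'
  -- `q′ q = 1 = q q′`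
  have hlat := latticeOfGL_coe_eq_one_of_mem_principalLevelSubgroup_one hr
  have hlat' := latticeOfGL_coe_eq_one_of_mem_principalLevelSubgroup_one hr'
  have hq'q : q' * q = 1 := by
    rw [← sub_eq_zero]
    refine eq_zero_of_forall_mulVec_int _ fun v => ?_
    have h1 : m.r (q' *ᵥ (q *ᵥ v)) = m.r v := by rw [← hq', ← hq]
    have h2 := (m.r_eq_r_iff_sub_mem_latticeOfGL _ _).1 h1
    rw [hlat, mem_latticeOfGL_one_iff] at h2
    simpa only [Matrix.sub_mulVec, Matrix.one_mulVec, ← Matrix.mulVec_mulVec] using h2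
  have hqq' : q * q' = 1 := by
    rw [← sub_eq_zero]
    refine eq_zero_of_forall_mulVec_int _ fun v => ?_
    have h1 : m'.r (q *ᵥ (q' *ᵥ v)) = m'.r v := by rw [← hq, ← hq']
    have h2 := (m'.r_eq_r_iff_sub_mem_latticeOfGL _ _).1 h1
    rw [hlat', mem_latticeOfGL_one_iff] at h2
    simpa only [Matrix.sub_mulVec, Matrix.one_mulVec, ← Matrix.mulVec_mulVec] using h2
  set qGL : GL (Fin g ⊕ Fin g) ℚ := ⟨q, q', hqq', hq'q⟩ with hqGL
  -- (3) `q` is a rational similitude of `E_δ`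
  have hpair : ∀ ⦃M : ℕ⦄
      [IsDominant (AbelianVariety.Hom.toSchemeHom (((M : ℕ) : ℤ) • 𝟙 (P'.A.fibre (𝟙 _)).toAbelianVariety))]
      (P₁ P₂ : (P'.A.fibre (𝟙 _)).toAbelianVariety.torsionPoints ℂ (M : ℤ)),
      (P'.A.fibre (𝟙 _)).toAbelianVariety.weilPairingLevel Θ P₁ P₂ =
        (P'.A.fibre (𝟙 _)).toAbelianVariety.weilPairingLevel Θ' P₁ P₂ :=
    fun M _ P₁ P₂ => AbelianSchemeOver.IsLambdaOfAt.weilPairingLevel_eq P'.A P'.D P'.pol.lam (𝟙 _) hΘl hΘl' P₁ P₂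
  have hqQ : ∀ v, m.r v = m'.r (Q.map (Int.castRingHom ℚ) *ᵥ v) := by rw [hQq]; exact hq
  have hF := smul_transpose_mul_typeForm_mul_eq_of_lifts₂ hδ hg hN0 hr hr' Λ m hΛ Λ' m' hΛ' hpair hqQ
  set d : ℤ := typeForm δ (Sum.inl ⟨0, hg⟩) (Sum.inr ⟨0, hg⟩) with hd
  set F : Matrix (Fin g ⊕ Fin g) (Fin g ⊕ Fin g) ℤ := Qᵀ * typeForm δ * Q with hFdef
  have hd0 : d ≠ 0 := by
    rw [hd, typeForm, Matrix.fromBlocks_apply₁₂, Matrix.diagonal_apply_eq]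
    exact Nat.cast_ne_zero.2 (hδ.1 ⟨0, hg⟩).ne'
  have hQQ' : Q * Q' = 1 := by
    have hinj : Function.Injective (fun X : Matrix (Fin g ⊕ Fin g) (Fin g ⊕ Fin g) ℤ => X.map (Int.castRingHom ℚ)) :=
      fun X Y hXY => by
        ext i j
        have := congrFun (congrFun hXY i) j
        simpa using this
    apply hinj
    simp only [Matrix.map_mul, hQq, hQ'q, hqq', Matrix.map_one (Int.castRingHom ℚ) (map_zero _) (map_one _)]
  have hdetQ : Q.det ≠ 0 := by
    intro h0
    have := congrArg Matrix.det hQQ'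
    rw [Matrix.det_mul, h0, zero_mul, Matrix.det_one] at this
    exact zero_ne_one this
  have hdetE : (typeForm δ).det ≠ 0 := by
    intro h0
    apply det_typeFormOver_rat_ne_zero hδ.1
    rw [typeFormOver, ← RingHom.mapMatrix_apply, ← RingHom.map_det, h0, map_zero]
  have hF0 : F (Sum.inl ⟨0, hg⟩) (Sum.inr ⟨0, hg⟩) ≠ 0 := by
    intro h0
    rw [h0, zero_smul, smul_eq_zero] at hF
    rcases hF with h1 | h1
    · exact hd0 h1
    · haveI : Nonempty (Fin g ⊕ Fin g) := ⟨Sum.inl ⟨0, hg⟩⟩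
      have := congrArg Matrix.det h1
      rw [Matrix.det_mul, Matrix.det_mul, Matrix.det_transpose, Matrix.det_zero] at this
      exact mul_ne_zero (mul_ne_zero hdetQ hdetE) hdetQ this
  set ν : ℚ := (F (Sum.inl ⟨0, hg⟩) (Sum.inr ⟨0, hg⟩) : ℚ) / d with hν
  have hν0 : ν ≠ 0 := div_ne_zero (Int.cast_ne_zero.2 hF0) (Int.cast_ne_zero.2 hd0)
  have hdQ : (d : ℚ) ≠ 0 := Int.cast_ne_zero.2 hd0
  have hsim : IsMultiplier (typeFormOver δ ℚ) qGL (Units.mk0 ν hν0) := by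
    rw [isMultiplier_iff, Units.val_mk0]
    change qᵀ * typeFormOver δ ℚ * q = ν • typeFormOver δ ℚ
    rw [← hQq, typeFormOver, ← Matrix.transpose_map, ← Matrix.map_mul, ← Matrix.map_mul]
    ext i j
    have hij := congrFun (congrFun hF i) j
    simp only [Matrix.smul_apply, smul_eq_mul] at hij
    rw [Matrix.map_apply, Matrix.smul_apply, Matrix.map_apply, smul_eq_mul, hν, eq_intCast, eq_intCast,
      div_mul_eq_mul_div, eq_div_iff hdQ]
    exact_mod_cast (mul_comm _ _).trans hij
  set γ : gspRational δ := ⟨qGL, Units.mk0 ν hν0, hsim⟩ with hγ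
  -- (4) `q̂ ∈ K_δ(1)` (integral with integral inverse) and its residue is `Q̄`
  have hqA : (((gspRationalToFinAdelic δ γ : gspFinAdelic δ) : GL (Fin g ⊕ Fin g) finAdeleQ) :
      Matrix (Fin g ⊕ Fin g) (Fin g ⊕ Fin g) finAdeleQ) = Q.map (Int.castRingHom finAdeleQ) := by
    rw [coe_gspRationalToFinAdelic, ← map_intCast_map_algebraMap Q, hQq]; rfl
  have hqA' : ((((gspRationalToFinAdelic δ γ : gspFinAdelic δ) : GL (Fin g ⊕ Fin g) finAdeleQ)⁻¹ :
      GL (Fin g ⊕ Fin g) finAdeleQ) : Matrix (Fin g ⊕ Fin g) (Fin g ⊕ Fin g) finAdeleQ) =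
      Q'.map (Int.castRingHom finAdeleQ) := by
    rw [coe_gspRationalToFinAdelic, ← map_inv, ← map_intCast_map_algebraMap Q', hQ'q]; rfl
  have hq1 : gspRationalToFinAdelic δ γ ∈ principalLevelSubgroup δ 1 := by
    rw [mem_principalLevelSubgroup_iff]
    refine ⟨?_, ?_⟩
    · rw [hqA]; exact (isCongOne_map_intCast_iff one_ne_zero Q).2 (Subsingleton.elim _ _)
    · rw [hqA']; exact (isCongOne_map_intCast_iff one_ne_zero Q').2 (Subsingleton.elim _ _)
  set θ : principalLevelSubgroup δ 1 := ⟨gspRationalToFinAdelic δ γ, hq1⟩ with hθ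
  have hredθ : ((red θ : GL (Fin g ⊕ Fin g) (ZMod N)) : Matrix (Fin g ⊕ Fin g) (Fin g ⊕ Fin g) (ZMod N)) =
      Q.map (Int.castRingHom (ZMod N)) := by
    ext i j
    have hmem : (((gspRationalToFinAdelic δ γ : gspFinAdelic δ) : GL (Fin g ⊕ Fin g) finAdeleQ) :
        Matrix (Fin g ⊕ Fin g) (Fin g ⊕ Fin g) finAdeleQ) i j ∈ FiniteAdeleRing.integralAdeles (𝓞 ℚ) ℚ := by
      rw [hqA, Matrix.map_apply, eq_intCast]; exact intCast_mem _ _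
    rw [hred θ i j hmem, Matrix.map_apply, eq_intCast]
    have hxval : (((gspRationalToFinAdelic δ γ : gspFinAdelic δ) : GL (Fin g ⊕ Fin g) finAdeleQ) :
        Matrix (Fin g ⊕ Fin g) (Fin g ⊕ Fin g) finAdeleQ) i j = ((Q i j : ℤ) : finAdeleQ) := by
      rw [hqA, Matrix.map_apply, eq_intCast]
    have hx : (⟨_, hmem⟩ : FiniteAdeleRing.integralAdeles (𝓞 ℚ) ℚ) =
        ⟨((Q i j : ℤ) : finAdeleQ), intCast_mem _ (Q i j)⟩ := Subtype.ext hxval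
    rw [hx]
    exact integralAdeleResidue_intCast N (Q i j)
  -- (5) `k := r′⁻¹ q̂ r ∈ K_δ(N)`: its residue is `Γ′_N · Γ′_N⁻¹Γ_N · Γ_N⁻¹ = 1`
  set κ : principalLevelSubgroup δ 1 := ρ' * θ * ⟨r, hr⟩ with hκ
  have hρr : red ⟨r, hr⟩ = (red ρ)⁻¹ := by
    rw [eq_inv_iff_mul_eq_one, ← map_mul]
    have : (⟨r, hr⟩ : principalLevelSubgroup δ 1) * ρ = 1 := Subtype.ext (mul_inv_cancel r)
    rw [this, map_one]
  have hredκ : red κ = 1 := by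
    rw [hκ, map_mul, map_mul, hρr]
    apply Units.ext
    rw [Units.val_mul, Units.val_mul, hredθ, hQN, Units.val_mul, ← Matrix.mul_assoc, ← Units.val_mul, mul_inv_cancel,
      Units.val_one, Matrix.one_mul, ← Units.val_mul, mul_inv_cancel, Units.val_one]
  have hκN : ((κ : principalLevelSubgroup δ 1) : gspFinAdelic δ) ∈ principalLevelSubgroup δ N := (hker κ).1 hredκ
  have hκval : ((κ : principalLevelSubgroup δ 1) : gspFinAdelic δ) = r'⁻¹ * gspRationalToFinAdelic δ γ * r := rfl
  -- (6) conclude with ★ `mk_eq_mk_of_hom` for `𝟙`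
  refine m.mk_eq_mk_of_hom m' (principalLevelSubgroup δ N) (𝟙 _)
    ⟨r'⁻¹ * gspRationalToFinAdelic δ γ * r, hκval ▸ hκN, fun v w hvw => ?_⟩
  rw [mul_inv_cancel_right] at hvw
  have hint' : ∀ i j, (((r' : gspFinAdelic δ) : GL (Fin g ⊕ Fin g) finAdeleQ) :
      Matrix (Fin g ⊕ Fin g) (Fin g ⊕ Fin g) finAdeleQ) i j ∈ FiniteAdeleRing.integralAdeles (𝓞 ℚ) ℚ :=
    isIntegral_of_isCongOne_one ((mem_principalLevelSubgroup_iff δ).1 hr').1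
  have h2 := hvw.mul_left (u := ((r' : gspFinAdelic δ) : GL (Fin g ⊕ Fin g) finAdeleQ)) hint'
  rw [← Subgroup.coe_mul, ← Subgroup.coe_mul, mul_inv_cancel_left, mul_inv_cancel, Subgroup.coe_one] at h2
  -- `h2 : q̂ v̂ ≡ ŵ (mod ℤ̂^{2g})`, i.e. `q v − w ∈ ℤ^{2g}`
  have hqv : AdelicCongr (1 : GL (Fin g ⊕ Fin g) finAdeleQ) 1 (q *ᵥ v) w := by
    intro i
    have := h2 i
    rw [hqA, ← map_intCast_map_algebraMap Q, hQq, Units.val_one, Matrix.one_mulVec] at this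
    rw [Units.val_one, Matrix.one_mulVec, Matrix.one_mulVec, ← adelicMatrix_mulVec_adelicVec]
    exact this
  have hww : AdelicCongr (1 : GL (Fin g ⊕ Fin g) finAdeleQ) 1 w w := fun i => by
    rw [sub_self, Pi.zero_apply]; exact zero_mem _
  have hmem := adelicCongr_zero_right_iff.1 (by simpa only [sub_self] using hqv.sub hww)
  rw [inv_one] at hmem
  have h := hq0 v
  simp only [AbelianVariety.id_hom] at h ⊢
  rw [h]
  refine (m'.r_eq_r_iff_sub_mem_latticeOfGL _ _).2 ?_
  rw [hlat']
  exact hmem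

/-- **U-b: THE COMPONENT INDEX IS UNIQUE** ([Milne 2005, Lemma 5.12/5.13, Thm. 5.17]: the pieces of `Sh_{K_δ(N)}` over the
integral principal representatives `r_c = diag(1, u·1)`, `u ∈ ẑ^×`, `u ≡ c (mod N)`, `c ∈ (ℤ/N)ˣ`, are disjoint).  If ONE
triple `P′` over `Spec ℂ` is admissible at `(Z, r_c)` and at `(Z′, r_{c′})` — the representatives hypothesised as in the
(U3) clause of ★ `siegelModuli_complexUniformisation` / ★ `SiegelShimuraSet.exists_principalRep` (multipliers `u, u′` with
residues `c, c′`, `u′ ∈ ẑ^×`; the block shape and the integrality of `u` are not needed) — then `c = c′`: the class map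
`x ↦ c(x)` on `𝓜(ℂ)` of U-DAG node U-b is well defined.
[cite: Milne2005ShimuraVarieties, Lemma 5.12 p. 57, Lemma 5.13 p. 57, Thm. 5.17 p. 59] [cite: Deligne1971TravauxShimura, Exemple 4.16 p. 150] -/
theorem units_zmod_eq_of_isAdmissibleAt (hg : 0 < g) (hδ : IsPolarizationType δ) (hN : 3 ≤ N)
    {c c' : (ZMod N)ˣ} {u u' : finAdeleQˣ}
    (huc : (u : finAdeleQ) - ((c : ZMod N).val : ℕ) ∈ levelIdeal N)
    (hr : r ∈ principalLevelSubgroup δ 1) (hru : IsMultiplier (typeFormOver δ finAdeleQ) (r : GL (Fin g ⊕ Fin g) finAdeleQ) u)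
    (hu' : ∀ v, Valued.v ((u' : finAdeleQ) v) = 1) (hu'c' : (u' : finAdeleQ) - ((c' : ZMod N).val : ℕ) ∈ levelIdeal N)
    (hr' : r' ∈ principalLevelSubgroup δ 1)
    (hr'u' : IsMultiplier (typeFormOver δ finAdeleQ) (r' : GL (Fin g ⊕ Fin g) finAdeleQ) u')
    (hZ : Z ∈ siegelUpperHalfSpace g) (hZ' : Z' ∈ siegelUpperHalfSpace g)
    (P' : PolarizedAbelianSchemeWithLevel g N δ (specOver ℚ ℂ).left)
    (h : IsAdmissibleAt hδ r Z hZ P') (h' : IsAdmissibleAt hδ r' Z' hZ' P') : c = c' := by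
  have hN0 : N ≠ 0 := by omega
  haveI : NeZero N := ⟨hN0⟩
  have hmk := siegelShimuraSet_mk_eq_of_isAdmissibleAt₂ hg hδ hN hr hr' hZ hZ' P' h h'
  have ha : (u : finAdeleQ) - (((c : ZMod N).val : ℤ) : finAdeleQ) ∈ levelIdeal N := by exact_mod_cast huc
  have ha' : (u' : finAdeleQ) - (((c' : ZMod N).val : ℤ) : finAdeleQ) ∈ levelIdeal N := by exact_mod_cast hu'c'
  have hdvd := intCast_dvd_sub_of_mk_jOfSiegel_eq_mk_jOfSiegel hδ hg hN0 hr hr' hru hr'u' hu' ha ha'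
    (Z := ⟨Z, hZ⟩) (Z' := ⟨Z', hZ'⟩) hmk
  have hcc : ((c : ZMod N)) - (c' : ZMod N) = 0 := by
    have := (ZMod.intCast_zmod_eq_zero_iff_dvd _ N).2 hdvd
    push_cast at this
    rwa [ZMod.natCast_zmod_val, ZMod.natCast_zmod_val] at this
  exact Units.ext (sub_eq_zero.1 hcc)

end Main

end Literature.AlgebraicGeometry.ModuliOfAbelianVarieties

end
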